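import Literature.Analysis.FluidPDE.KatoLaiBilinearBounds
import Literature.Analysis.FluidPDE.KatoLaiLevels
import HarnessLib

/-!
# Kato–Lai's bilinear form on the coefficient space: `H^{m+1} × H^{m+1} → H^m` inside `SymL2`

Analysis/FluidPDE support file for the energy-method construction of Euler flows in the
periodic cylinder (`Literature.Analysis.FluidPDE.KatoLai1984_periodicCylinderUniformExistence`;
Kato–Lai 1984, §4–§5: `A(v) = F(Pv, v) − QF(Pv, Pv)` is a bounded quadratic map `H^s → H^{s-1}`).
With the level readings of `KatoLaiLevels` (`X = SymL2 (Fin 3)`, `wt m`, `AtLevel`), for `m ≥ 2`: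

* `toLev m hZ` — the smooth torus field `Z` read at level `m` (`‖toLev m Z‖² = lat_m Z`);
  `lvField m N F` — the level-`m` trigonometric polynomial of `F ∈ X` on the ball
  (`toLev m (lvField m N F) = trunc N F`);
* `bilExt hL hm : X →L[ℝ] X →L[ℝ] X` — **the bounded bilinear map** obtained as the limit of
  `toLev m (klBil (lvField (m+1) N F) (lvField (m+1) N G))` (Cauchy by `exists_latNormSq_klBil_le`);
  `bilExt_toLev` — on smooth fields it is `toLev m (klBil Z Z')`;
* `atLevel_klOpExt_bilExt` — **consistency with `𝒜̂`**: for `f` in the level-`s` space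
  (`m + 1 ≤ s`) and `F = levelOf (m+1) f`, `bilExt F F` is `klOpExt f` read at level `m`.

Everything is proved; no named fact and no `sorry` is introduced.

## References

* T. Kato, C. Y. Lai, J. Funct. Anal. 56 (1984) 15–28, §4, §5. [KatoLai1984]
-/

noncomputable section

open MeasureTheory Set Function Filter Topology TopologicalSpace Finset
open scoped NNReal ENNReal InnerProductSpace RealInnerProductSpace

namespace Literature.Analysis.FluidPDE

open FunctionSpaces FunctionSpaces.Torus UnitAddTorus

/-- Local notation for physical space `ℝ³ = EuclideanSpace ℝ (Fin 3)`. -/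
local notation "ℝ³" => EuclideanSpace ℝ (Fin 3)

namespace PeriodicCylinder

/-! ### Smooth fields read at a level -/

/-- `wt m` is a weight. [folklore] -/
theorem isWeight_wt (m : ℕ) : SymL2.IsWeight (wt m) := ⟨wt_pos m, wt_neg m⟩

/-- `wt m` has polynomial growth. [folklore] -/
theorem polyGrowth_wt (m : ℕ) : SymL2.PolyGrowth (wt m) := by
  refine ⟨1, m, fun k => ?_⟩
  rw [abs_of_pos (wt_pos m k), one_mul]
  have h1 := one_le_wt m k
  have h2 := wt_sq m k
  nlinarith

/-- **A smooth torus field read at level `m`**: stores `wt m k · Ẑ k`. [folklore] -/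
def toLev (m : ℕ) {Z : UnitAddTorus (Fin 3) → ℝ³} (hZ : IsSmooth Z) : SymL2 (Fin 3) :=
  SymL2.ofSmooth (wt m) (isWeight_wt m) (polyGrowth_wt m) Z hZ

/-- `toLev m Z` is `toL2 Z` at level `m`. [folklore] -/
theorem atLevel_toL2_toLev (m : ℕ) {Z : UnitAddTorus (Fin 3) → ℝ³} (hZ : IsSmooth Z) : AtLevel m (toL2 hZ) (toLev m hZ) := fun k => by
  rw [toLev, SymL2.ofSmooth_apply, SymL2.ofSmooth_apply]; simp

/-- `‖toLev m Z‖² = lat_m Z`. [folklore] -/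
theorem norm_toLev_sq (m : ℕ) {Z : UnitAddTorus (Fin 3) → ℝ³} (hZ : IsSmooth Z) : ‖toLev m hZ‖ ^ 2 = Torus.latNormSq m Z :=
  (atLevel_toL2_toLev m hZ).norm_sq_eq_latNormSq hZ

/-- `toLev` of a difference. [folklore] -/
theorem toLev_sub (m : ℕ) {Z Z' : UnitAddTorus (Fin 3) → ℝ³} (hZ : IsSmooth Z) (hZ' : IsSmooth Z') :
    toLev m (hZ.sub hZ') = toLev m hZ - toLev m hZ' :=
  ofSmooth_fun_sub (isWeight_wt m) (polyGrowth_wt m) hZ hZ'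

/-- `toLev` only depends on the field. [folklore] -/
theorem toLev_congr (m : ℕ) {Z Z' : UnitAddTorus (Fin 3) → ℝ³} (hZ : IsSmooth Z) (hZ' : IsSmooth Z') (e : Z = Z') :
    toLev m hZ = toLev m hZ' := by subst e; rfl

/-! ### The level trigonometric polynomial of an element of `X` -/

/-- **The level-`m` trigonometric polynomial** of `F ∈ X` on the ball: physical coefficients
`wt m ⁻¹ F`. [folklore] -/
def lvField (m : ℕ) (N : ℕ) (F : SymL2 (Fin 3)) : UnitAddTorus (Fin 3) → ℝ³ :=
  realTrigPoly (freqBall N) (SymL2.coef (wt m) F)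

/-- It is smooth. [folklore] -/
theorem isSmooth_lvField (m N : ℕ) (F : SymL2 (Fin 3)) : IsSmooth (lvField m N F) := isSmooth_realTrigPoly _ _

/-- Its Fourier coefficients. [folklore] -/
theorem mFourierCoeff_lvField (m N : ℕ) (F : SymL2 (Fin 3)) (k : Fin 3 → ℤ) :
    mFourierCoeff (EuclideanSpace.complexify ∘ lvField m N F) k = if k ∈ freqBall N then SymL2.coef (wt m) F k else 0 :=
  mFourierCoeff_realTrigPoly neg_mem_freqBall_of_mem (SymL2.isConjSymm_coef (isWeight_wt m) F) k

/-- **`toLev m (lvField m N F) = trunc N F`.** [folklore] -/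
theorem toLev_lvField (m N : ℕ) (F : SymL2 (Fin 3)) : toLev m (isSmooth_lvField m N F) = SymL2.trunc N F := by
  refine SymL2.ext fun k => ?_
  rw [toLev, SymL2.ofSmooth_apply, mFourierCoeff_lvField, SymL2.trunc_apply]
  split_ifs with hk
  · exact SymL2.smul_coef (isWeight_wt m) F k
  · simp

/-- `lvField` of a difference. [folklore] -/
theorem lvField_sub (m N : ℕ) (F G : SymL2 (Fin 3)) : lvField m N (F - G) = fun ξ => lvField m N F ξ - lvField m N G ξ := by
  funext ξ
  simp only [lvField, realTrigPoly_apply, trigPoly_apply, SymL2.coef_sub, smul_sub, sum_sub_distrib, map_sub]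

/-- `lvField` of a sum. [folklore] -/
theorem lvField_add (m N : ℕ) (F G : SymL2 (Fin 3)) : lvField m N (F + G) = fun ξ => lvField m N F ξ + lvField m N G ξ := by
  funext ξ
  simp only [lvField, realTrigPoly_apply, trigPoly_apply, SymL2.coef_add, smul_add, sum_add_distrib, map_add]

/-- `lvField` of a multiple. [folklore] -/
theorem lvField_smul (m N : ℕ) (c : ℝ) (F : SymL2 (Fin 3)) : lvField m N (c • F) = fun ξ => c • lvField m N F ξ := by
  funext ξ
  simp only [lvField, realTrigPoly_apply, trigPoly_apply]
  rw [← map_smul, Finset.smul_sum]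
  congr 1
  refine Finset.sum_congr rfl fun k _ => ?_
  rw [SymL2.coef_apply, SymL2.coef_apply, SymL2.smul_apply, Complex.coe_smul, smul_comm _ c, smul_comm _ c]

/-- `lat_{m}(lvField m N F) ≤ ‖F‖²`. [folklore] -/
theorem latNormSq_lvField_le (m N : ℕ) (F : SymL2 (Fin 3)) : Torus.latNormSq m (lvField m N F) ≤ ‖F‖ ^ 2 := by
  rw [← norm_toLev_sq m (isSmooth_lvField m N F), toLev_lvField]
  exact pow_le_pow_left₀ (norm_nonneg _) (SymL2.norm_trunc_le N F) 2

/-! ### The approximants of the bilinear map -/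

section Bil

variable {L : ℝ} (hL : 0 < L) {m : ℕ}

/-- The value of the bilinear form on two trigonometric polynomials, read at level `m`. [folklore] -/
def bilApprox (hL : 0 < L) (m : ℕ) (N : ℕ) (F G : SymL2 (Fin 3)) : SymL2 (Fin 3) :=
  toLev m (isSmooth_klBil hL (isSmooth_lvField (m + 1) N F) (isSmooth_lvField (m + 1) N G))

/-- `klBil` only depends on the fields. [folklore] -/
theorem klBil_congr {U U' V V' : UnitAddTorus (Fin 3) → ℝ³} (hU : IsSmooth U) (hU' : IsSmooth U') (hV : IsSmooth V) (hV' : IsSmooth V')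
    (eU : U = U') (eV : V = V') : klBil hL hU hV = klBil hL hU' hV' := by subst eU; subst eV; rfl

/-- The difference of two values of the form, by bilinearity:
`klBil A B − klBil A' B' = klBil (A − A') B + klBil A' (B − B')`. [folklore] -/
theorem klBil_sub_sub {A A' B B' : UnitAddTorus (Fin 3) → ℝ³} (hA : IsSmooth A) (hA' : IsSmooth A') (hB : IsSmooth B) (hB' : IsSmooth B') :
    (fun ξ => klBil hL hA hB ξ - klBil hL hA' hB' ξ) =
      fun ξ => klBil hL (hA.sub hA') hB ξ + klBil hL hA' (hB.sub hB') ξ := by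
  -- `A = (A − A') + A'`, `B = (B − B') + B'`
  have hsA : IsSmooth (fun ξ => (A ξ - A' ξ) + A' ξ) := (hA.sub hA').add hA'
  have hsB : IsSmooth (fun ξ => (B ξ - B' ξ) + B' ξ) := (hB.sub hB').add hB'
  have eA : (fun ξ => (A ξ - A' ξ) + A' ξ) = A := by funext ξ; abel
  have eB : (fun ξ => (B ξ - B' ξ) + B' ξ) = B := by funext ξ; abel
  have h1 : klBil hL hA hB = klBil hL hsA hB := klBil_congr hL hA hsA hB hB eA.symm rfl
  have h2 : klBil hL hsA hB = fun ξ => klBil hL (hA.sub hA') hB ξ + klBil hL hA' hB ξ := klBil_add_left hL (hA.sub hA') hA' hB hsA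
  have h3 : klBil hL hA' hB = klBil hL hA' hsB := klBil_congr hL hA' hA' hB hsB rfl eB.symm
  have h4 : klBil hL hA' hsB = fun ξ => klBil hL hA' (hB.sub hB') ξ + klBil hL hA' hB' ξ := klBil_add_right hL (hB.sub hB') hB' hA' hsB
  funext ξ
  rw [h1, h2]
  simp only
  rw [h3, h4]
  simp only
  abel

/-- The raw bilinear map: the limit of the approximants. [folklore] -/
def bilExtFun (hL : 0 < L) (m : ℕ) (F G : SymL2 (Fin 3)) : SymL2 (Fin 3) := limUnder atTop fun N => bilApprox hL m N F G

variable (hm : 2 ≤ m)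
include hm

/-- **The basic estimate**: `‖toLev m (klBil A B)‖² ≤ K ‖toLev (m+1) A‖² ‖toLev (m+1) B‖²`. [folklore] -/
theorem exists_norm_toLev_klBil_sq_le : ∃ K : ℝ, 0 ≤ K ∧
    ∀ (A B : UnitAddTorus (Fin 3) → ℝ³) (hA : IsSmooth A) (hB : IsSmooth B),
      ‖toLev m (isSmooth_klBil hL hA hB)‖ ^ 2 ≤ K * ‖toLev (m + 1) hA‖ ^ 2 * ‖toLev (m + 1) hB‖ ^ 2 := by
  obtain ⟨K, hK0, hK⟩ := exists_latNormSq_klBil_le hL hm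
  refine ⟨K, hK0, fun A B hA hB => ?_⟩
  rw [norm_toLev_sq, norm_toLev_sq, norm_toLev_sq]
  exact hK A B hA hB

/-- **The Lipschitz bound of the approximants**:
`‖bilApprox N F G − bilApprox N' F' G'‖ ≤ √K (‖T F − T' F'‖ ‖G‖ + ‖F'‖ ‖T G − T' G'‖)` with
`T = trunc N`, `T' = trunc N'`. [folklore] -/
theorem exists_norm_bilApprox_sub_le : ∃ K : ℝ, 0 ≤ K ∧
    ∀ (N N' : ℕ) (F G F' G' : SymL2 (Fin 3)),
      ‖bilApprox hL m N F G - bilApprox hL m N' F' G'‖ ≤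
        K * (‖SymL2.trunc N F - SymL2.trunc N' F'‖ * ‖G‖ + ‖F'‖ * ‖SymL2.trunc N G - SymL2.trunc N' G'‖) := by
  obtain ⟨K, hK0, hK⟩ := exists_norm_toLev_klBil_sq_le hL hm
  refine ⟨Real.sqrt K, Real.sqrt_nonneg K, fun N N' F G F' G' => ?_⟩
  have hA := isSmooth_lvField (m + 1) N F
  have hA' := isSmooth_lvField (m + 1) N' F'
  have hB := isSmooth_lvField (m + 1) N G
  have hB' := isSmooth_lvField (m + 1) N' G'
  have hsq : ∀ (A B : UnitAddTorus (Fin 3) → ℝ³) (hA : IsSmooth A) (hB : IsSmooth B),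
      ‖toLev m (isSmooth_klBil hL hA hB)‖ ≤ Real.sqrt K * ‖toLev (m + 1) hA‖ * ‖toLev (m + 1) hB‖ := fun A B hA hB => by
    have h := hK A B hA hB
    have h2 : ‖toLev m (isSmooth_klBil hL hA hB)‖ ^ 2 ≤ (Real.sqrt K * ‖toLev (m + 1) hA‖ * ‖toLev (m + 1) hB‖) ^ 2 := by
      rw [mul_pow, mul_pow, Real.sq_sqrt hK0]; exact h
    exact (pow_le_pow_iff_left₀ (norm_nonneg _) (by positivity) two_ne_zero).1 h2
  -- rewrite the difference through bilinearity
  have hd : IsSmooth (fun ξ => klBil hL hA hB ξ - klBil hL hA' hB' ξ) := (isSmooth_klBil hL hA hB).sub (isSmooth_klBil hL hA' hB')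
  have h1s := isSmooth_klBil hL (hA.sub hA') hB
  have h2s := isSmooth_klBil hL hA' (hB.sub hB')
  have hsum : IsSmooth (fun ξ => klBil hL (hA.sub hA') hB ξ + klBil hL hA' (hB.sub hB') ξ) := h1s.add h2s
  have e1 : bilApprox hL m N F G - bilApprox hL m N' F' G' = toLev m hd :=
    (toLev_sub m (isSmooth_klBil hL hA hB) (isSmooth_klBil hL hA' hB')).symm
  have e2 : toLev m hd = toLev m hsum := toLev_congr m hd hsum (klBil_sub_sub hL hA hA' hB hB')
  have e3 : toLev m hsum = toLev m h1s + toLev m h2s := SymL2.ofSmooth_add (isWeight_wt m) (polyGrowth_wt m) h1s h2s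
  rw [e1, e2, e3]
  -- the level-`m+1` readings of the differences
  have eA : toLev (m + 1) (hA.sub hA') = SymL2.trunc N F - SymL2.trunc N' F' := by
    rw [toLev_sub (m + 1) hA hA', toLev_lvField, toLev_lvField]
  have eB : toLev (m + 1) (hB.sub hB') = SymL2.trunc N G - SymL2.trunc N' G' := by
    rw [toLev_sub (m + 1) hB hB', toLev_lvField, toLev_lvField]
  have hB1 : ‖toLev (m + 1) hB‖ ≤ ‖G‖ := by rw [toLev_lvField]; exact SymL2.norm_trunc_le N G
  have hA'1 : ‖toLev (m + 1) hA'‖ ≤ ‖F'‖ := by rw [toLev_lvField]; exact SymL2.norm_trunc_le N' F'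
  calc ‖toLev m h1s + toLev m h2s‖ ≤ ‖toLev m h1s‖ + ‖toLev m h2s‖ := norm_add_le _ _
    _ ≤ Real.sqrt K * ‖toLev (m + 1) (hA.sub hA')‖ * ‖toLev (m + 1) hB‖ + Real.sqrt K * ‖toLev (m + 1) hA'‖ * ‖toLev (m + 1) (hB.sub hB')‖ :=
        add_le_add (hsq _ _ _ _) (hsq _ _ _ _)
    _ ≤ Real.sqrt K * ‖SymL2.trunc N F - SymL2.trunc N' F'‖ * ‖G‖ + Real.sqrt K * ‖F'‖ * ‖SymL2.trunc N G - SymL2.trunc N' G'‖ := by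
        rw [eA, eB]
        refine add_le_add (mul_le_mul_of_nonneg_left hB1 (by positivity)) ?_
        exact mul_le_mul_of_nonneg_right (mul_le_mul_of_nonneg_left hA'1 (Real.sqrt_nonneg _)) (norm_nonneg _)
    _ = _ := by ring

/-- The approximants are Cauchy. [folklore] -/
theorem cauchySeq_bilApprox (F G : SymL2 (Fin 3)) : CauchySeq fun N => bilApprox hL m N F G := by
  obtain ⟨K, hK0, hK⟩ := exists_norm_bilApprox_sub_le hL hm
  have hF : CauchySeq fun N => SymL2.trunc N F := (SymL2.tendsto_trunc F).cauchySeq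
  have hG : CauchySeq fun N => SymL2.trunc N G := (SymL2.tendsto_trunc G).cauchySeq
  rw [Metric.cauchySeq_iff] at hF hG ⊢
  intro δ hδ
  set M : ℝ := K * (‖G‖ + ‖F‖) + 1 with hM
  have hMpos : 0 < M := by positivity
  obtain ⟨N₁, hN₁⟩ := hF (δ / M) (div_pos hδ hMpos)
  obtain ⟨N₂, hN₂⟩ := hG (δ / M) (div_pos hδ hMpos)
  refine ⟨max N₁ N₂, fun N hN N' hN' => ?_⟩
  rw [dist_eq_norm]
  have h1 := hN₁ N (le_of_max_le_left hN) N' (le_of_max_le_left hN')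
  have h2 := hN₂ N (le_of_max_le_right hN) N' (le_of_max_le_right hN')
  rw [dist_eq_norm] at h1 h2
  calc ‖bilApprox hL m N F G - bilApprox hL m N' F G‖
      ≤ K * (‖SymL2.trunc N F - SymL2.trunc N' F‖ * ‖G‖ + ‖F‖ * ‖SymL2.trunc N G - SymL2.trunc N' G‖) := hK N N' F G F G
    _ ≤ K * (δ / M * ‖G‖ + ‖F‖ * (δ / M)) := by
        refine mul_le_mul_of_nonneg_left (add_le_add ?_ ?_) hK0
        · exact mul_le_mul_of_nonneg_right h1.le (norm_nonneg _)
        · exact mul_le_mul_of_nonneg_left h2.le (norm_nonneg _)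
    _ = δ * (K * (‖G‖ + ‖F‖) / M) := by ring
    _ < δ := by
        have : K * (‖G‖ + ‖F‖) / M < 1 := by rw [div_lt_one hMpos, hM]; linarith
        nlinarith

/-- The approximants converge. [folklore] -/
theorem tendsto_bilApprox (F G : SymL2 (Fin 3)) : Tendsto (fun N => bilApprox hL m N F G) atTop (𝓝 (bilExtFun hL m F G)) :=
  (cauchySeq_bilApprox hL hm F G).tendsto_limUnder

/-- **The bound**: `‖bilExtFun F G‖ ≤ C ‖F‖ ‖G‖`. [folklore] -/
theorem exists_norm_bilExtFun_le : ∃ C : ℝ, 0 ≤ C ∧ ∀ F G : SymL2 (Fin 3), ‖bilExtFun hL m F G‖ ≤ C * ‖F‖ * ‖G‖ := by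
  obtain ⟨K, hK0, hK⟩ := exists_norm_toLev_klBil_sq_le hL hm
  refine ⟨Real.sqrt K, Real.sqrt_nonneg K, fun F G => le_of_tendsto' (tendsto_bilApprox hL hm F G).norm fun N => ?_⟩
  have hA := isSmooth_lvField (m + 1) N F
  have hB := isSmooth_lvField (m + 1) N G
  have h := hK _ _ hA hB
  rw [toLev_lvField, toLev_lvField] at h
  have h2 : ‖bilApprox hL m N F G‖ ^ 2 ≤ (Real.sqrt K * ‖F‖ * ‖G‖) ^ 2 := by
    rw [mul_pow, mul_pow, Real.sq_sqrt hK0]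
    calc ‖bilApprox hL m N F G‖ ^ 2 ≤ K * ‖SymL2.trunc N F‖ ^ 2 * ‖SymL2.trunc N G‖ ^ 2 := h
      _ ≤ K * ‖F‖ ^ 2 * ‖G‖ ^ 2 := mul_le_mul (mul_le_mul_of_nonneg_left (pow_le_pow_left₀ (norm_nonneg _) (SymL2.norm_trunc_le N F) 2) hK0)
          (pow_le_pow_left₀ (norm_nonneg _) (SymL2.norm_trunc_le N G) 2) (sq_nonneg _) (by positivity)
  exact (pow_le_pow_iff_left₀ (norm_nonneg _) (by positivity) two_ne_zero).1 h2

omit hm in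
/-- The approximants are additive in the first argument. [folklore] -/
theorem bilApprox_add_left (N : ℕ) (F F' G : SymL2 (Fin 3)) :
    bilApprox hL m N (F + F') G = bilApprox hL m N F G + bilApprox hL m N F' G := by
  have hA := isSmooth_lvField (m + 1) N F
  have hA' := isSmooth_lvField (m + 1) N F'
  have hB := isSmooth_lvField (m + 1) N G
  have hs : IsSmooth (fun ξ => lvField (m + 1) N F ξ + lvField (m + 1) N F' ξ) := hA.add hA'
  have e : lvField (m + 1) N (F + F') = fun ξ => lvField (m + 1) N F ξ + lvField (m + 1) N F' ξ := lvField_add _ N F F'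
  have e2 : klBil hL (isSmooth_lvField (m + 1) N (F + F')) hB = fun ξ => klBil hL hA hB ξ + klBil hL hA' hB ξ := by
    rw [klBil_congr hL (isSmooth_lvField (m + 1) N (F + F')) hs hB hB e rfl, klBil_add_left hL hA hA' hB hs]
  have hsum : IsSmooth (fun ξ => klBil hL hA hB ξ + klBil hL hA' hB ξ) := (isSmooth_klBil hL hA hB).add (isSmooth_klBil hL hA' hB)
  calc bilApprox hL m N (F + F') G = toLev m hsum := toLev_congr m _ hsum e2
    _ = toLev m (isSmooth_klBil hL hA hB) + toLev m (isSmooth_klBil hL hA' hB) :=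
        SymL2.ofSmooth_add (isWeight_wt m) (polyGrowth_wt m) (isSmooth_klBil hL hA hB) (isSmooth_klBil hL hA' hB)

omit hm in
/-- The approximants are additive in the second argument. [folklore] -/
theorem bilApprox_add_right (N : ℕ) (F G G' : SymL2 (Fin 3)) :
    bilApprox hL m N F (G + G') = bilApprox hL m N F G + bilApprox hL m N F G' := by
  have hA := isSmooth_lvField (m + 1) N F
  have hB := isSmooth_lvField (m + 1) N G
  have hB' := isSmooth_lvField (m + 1) N G'
  have hs : IsSmooth (fun ξ => lvField (m + 1) N G ξ + lvField (m + 1) N G' ξ) := hB.add hB'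
  have e : lvField (m + 1) N (G + G') = fun ξ => lvField (m + 1) N G ξ + lvField (m + 1) N G' ξ := lvField_add _ N G G'
  have e2 : klBil hL hA (isSmooth_lvField (m + 1) N (G + G')) = fun ξ => klBil hL hA hB ξ + klBil hL hA hB' ξ := by
    rw [klBil_congr hL hA hA (isSmooth_lvField (m + 1) N (G + G')) hs rfl e, klBil_add_right hL hB hB' hA hs]
  have hsum : IsSmooth (fun ξ => klBil hL hA hB ξ + klBil hL hA hB' ξ) := (isSmooth_klBil hL hA hB).add (isSmooth_klBil hL hA hB')
  calc bilApprox hL m N F (G + G') = toLev m hsum := toLev_congr m _ hsum e2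
    _ = toLev m (isSmooth_klBil hL hA hB) + toLev m (isSmooth_klBil hL hA hB') :=
        SymL2.ofSmooth_add (isWeight_wt m) (polyGrowth_wt m) (isSmooth_klBil hL hA hB) (isSmooth_klBil hL hA hB')

omit hm in
/-- The approximants are homogeneous in the first argument. [folklore] -/
theorem bilApprox_smul_left (N : ℕ) (c : ℝ) (F G : SymL2 (Fin 3)) : bilApprox hL m N (c • F) G = c • bilApprox hL m N F G := by
  have hA := isSmooth_lvField (m + 1) N F
  have hB := isSmooth_lvField (m + 1) N G
  have hs : IsSmooth (fun ξ => c • lvField (m + 1) N F ξ) := hA.const_smul c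
  have e : lvField (m + 1) N (c • F) = fun ξ => c • lvField (m + 1) N F ξ := lvField_smul _ N c F
  have e2 : klBil hL (isSmooth_lvField (m + 1) N (c • F)) hB = fun ξ => c • klBil hL hA hB ξ := by
    rw [klBil_congr hL (isSmooth_lvField (m + 1) N (c • F)) hs hB hB e rfl, klBil_smul_left hL hA hB hs]
  have hsm : IsSmooth (fun ξ => c • klBil hL hA hB ξ) := (isSmooth_klBil hL hA hB).const_smul c
  calc bilApprox hL m N (c • F) G = toLev m hsm := toLev_congr m _ hsm e2
    _ = c • toLev m (isSmooth_klBil hL hA hB) := SymL2.ofSmooth_smul (isWeight_wt m) (polyGrowth_wt m) c (isSmooth_klBil hL hA hB)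

omit hm in
/-- The approximants are homogeneous in the second argument. [folklore] -/
theorem bilApprox_smul_right (N : ℕ) (c : ℝ) (F G : SymL2 (Fin 3)) : bilApprox hL m N F (c • G) = c • bilApprox hL m N F G := by
  have hA := isSmooth_lvField (m + 1) N F
  have hB := isSmooth_lvField (m + 1) N G
  have hs : IsSmooth (fun ξ => c • lvField (m + 1) N G ξ) := hB.const_smul c
  have e : lvField (m + 1) N (c • G) = fun ξ => c • lvField (m + 1) N G ξ := lvField_smul _ N c G
  have e2 : klBil hL hA (isSmooth_lvField (m + 1) N (c • G)) = fun ξ => c • klBil hL hA hB ξ := by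
    rw [klBil_congr hL hA hA (isSmooth_lvField (m + 1) N (c • G)) hs rfl e, klBil_smul_right hL hB hA hs]
  have hsm : IsSmooth (fun ξ => c • klBil hL hA hB ξ) := (isSmooth_klBil hL hA hB).const_smul c
  calc bilApprox hL m N F (c • G) = toLev m hsm := toLev_congr m _ hsm e2
    _ = c • toLev m (isSmooth_klBil hL hA hB) := SymL2.ofSmooth_smul (isWeight_wt m) (polyGrowth_wt m) c (isSmooth_klBil hL hA hB)

/-- Additivity in the first argument. [folklore] -/
theorem bilExtFun_add_left (F F' G : SymL2 (Fin 3)) : bilExtFun hL m (F + F') G = bilExtFun hL m F G + bilExtFun hL m F' G :=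
  tendsto_nhds_unique (tendsto_bilApprox hL hm (F + F') G)
    (((tendsto_bilApprox hL hm F G).add (tendsto_bilApprox hL hm F' G)).congr fun N => (bilApprox_add_left hL N F F' G).symm)

/-- Additivity in the second argument. [folklore] -/
theorem bilExtFun_add_right (F G G' : SymL2 (Fin 3)) : bilExtFun hL m F (G + G') = bilExtFun hL m F G + bilExtFun hL m F G' :=
  tendsto_nhds_unique (tendsto_bilApprox hL hm F (G + G'))
    (((tendsto_bilApprox hL hm F G).add (tendsto_bilApprox hL hm F G')).congr fun N => (bilApprox_add_right hL N F G G').symm)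

/-- Homogeneity in the first argument. [folklore] -/
theorem bilExtFun_smul_left (c : ℝ) (F G : SymL2 (Fin 3)) : bilExtFun hL m (c • F) G = c • bilExtFun hL m F G :=
  tendsto_nhds_unique (tendsto_bilApprox hL hm (c • F) G)
    (((tendsto_bilApprox hL hm F G).const_smul c).congr fun N => (bilApprox_smul_left hL N c F G).symm)

/-- Homogeneity in the second argument. [folklore] -/
theorem bilExtFun_smul_right (c : ℝ) (F G : SymL2 (Fin 3)) : bilExtFun hL m F (c • G) = c • bilExtFun hL m F G :=
  tendsto_nhds_unique (tendsto_bilApprox hL hm F (c • G))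
    (((tendsto_bilApprox hL hm F G).const_smul c).congr fun N => (bilApprox_smul_right hL N c F G).symm)

/-- **The bounded bilinear map** `H^{m+1} × H^{m+1} → H^m` on the coefficient space `X`.
[cite: KatoLai1984, §4 (4.2), (4.4)] -/
def bilExt : SymL2 (Fin 3) →L[ℝ] SymL2 (Fin 3) →L[ℝ] SymL2 (Fin 3) :=
  LinearMap.mkContinuous₂
    (LinearMap.mk₂ ℝ (bilExtFun hL m) (bilExtFun_add_left hL hm) (bilExtFun_smul_left hL hm)
      (bilExtFun_add_right hL hm) (bilExtFun_smul_right hL hm))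
    (Classical.choose (exists_norm_bilExtFun_le hL hm))
    (fun F G => (Classical.choose_spec (exists_norm_bilExtFun_le hL hm)).2 F G)

/-- Unfolding. [folklore] -/
theorem bilExt_apply (F G : SymL2 (Fin 3)) : bilExt hL hm F G = bilExtFun hL m F G := rfl

/-! ### Consistency -/

/-- Along smooth fields: if `Z_N → Z` and `Z'_N → Z'` at level `m+1` then
`toLev m (klBil Z_N Z'_N) → toLev m (klBil Z Z')`. [folklore] -/
theorem tendsto_toLev_klBil {Z Z' : UnitAddTorus (Fin 3) → ℝ³} (hZ : IsSmooth Z) (hZ' : IsSmooth Z')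
    {A B : ℕ → UnitAddTorus (Fin 3) → ℝ³} (hA : ∀ N, IsSmooth (A N)) (hB : ∀ N, IsSmooth (B N))
    (htA : Tendsto (fun N => toLev (m + 1) (hA N)) atTop (𝓝 (toLev (m + 1) hZ)))
    (htB : Tendsto (fun N => toLev (m + 1) (hB N)) atTop (𝓝 (toLev (m + 1) hZ'))) :
    Tendsto (fun N => toLev m (isSmooth_klBil hL (hA N) (hB N))) atTop (𝓝 (toLev m (isSmooth_klBil hL hZ hZ'))) := by
  obtain ⟨K, hK0, hK⟩ := exists_norm_toLev_klBil_sq_le hL hm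
  rw [tendsto_iff_norm_sub_tendsto_zero]
  -- `‖toLev (klBil A B) − toLev (klBil Z Z')‖ ≤ √K (‖tA − tZ‖ ‖tB‖ + ‖tZ‖ ‖tB − tZ'‖)`
  have hb : ∀ N, ‖toLev m (isSmooth_klBil hL (hA N) (hB N)) - toLev m (isSmooth_klBil hL hZ hZ')‖ ≤
      Real.sqrt K * (‖toLev (m + 1) (hA N) - toLev (m + 1) hZ‖ * ‖toLev (m + 1) (hB N)‖ +
        ‖toLev (m + 1) hZ‖ * ‖toLev (m + 1) (hB N) - toLev (m + 1) hZ'‖) := by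
    intro N
    have hsq : ∀ (P Q : UnitAddTorus (Fin 3) → ℝ³) (hP : IsSmooth P) (hQ : IsSmooth Q),
        ‖toLev m (isSmooth_klBil hL hP hQ)‖ ≤ Real.sqrt K * ‖toLev (m + 1) hP‖ * ‖toLev (m + 1) hQ‖ := fun P Q hP hQ => by
      have h := hK P Q hP hQ
      have h2 : ‖toLev m (isSmooth_klBil hL hP hQ)‖ ^ 2 ≤ (Real.sqrt K * ‖toLev (m + 1) hP‖ * ‖toLev (m + 1) hQ‖) ^ 2 := by
        rw [mul_pow, mul_pow, Real.sq_sqrt hK0]; exact h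
      exact (pow_le_pow_iff_left₀ (norm_nonneg _) (by positivity) two_ne_zero).1 h2
    have hd : IsSmooth (fun ξ => klBil hL (hA N) (hB N) ξ - klBil hL hZ hZ' ξ) := (isSmooth_klBil hL (hA N) (hB N)).sub (isSmooth_klBil hL hZ hZ')
    have h1s := isSmooth_klBil hL ((hA N).sub hZ) (hB N)
    have h2s := isSmooth_klBil hL hZ ((hB N).sub hZ')
    have hsum : IsSmooth (fun ξ => klBil hL ((hA N).sub hZ) (hB N) ξ + klBil hL hZ ((hB N).sub hZ') ξ) := h1s.add h2s
    have e1 : toLev m (isSmooth_klBil hL (hA N) (hB N)) - toLev m (isSmooth_klBil hL hZ hZ') = toLev m hd :=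
      (toLev_sub m (isSmooth_klBil hL (hA N) (hB N)) (isSmooth_klBil hL hZ hZ')).symm
    have e2 : toLev m hd = toLev m hsum := toLev_congr m hd hsum (klBil_sub_sub hL (hA N) hZ (hB N) hZ')
    have e3 : toLev m hsum = toLev m h1s + toLev m h2s := SymL2.ofSmooth_add (isWeight_wt m) (polyGrowth_wt m) h1s h2s
    rw [e1, e2, e3]
    calc ‖toLev m h1s + toLev m h2s‖ ≤ ‖toLev m h1s‖ + ‖toLev m h2s‖ := norm_add_le _ _
      _ ≤ Real.sqrt K * ‖toLev (m + 1) ((hA N).sub hZ)‖ * ‖toLev (m + 1) (hB N)‖ +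
          Real.sqrt K * ‖toLev (m + 1) hZ‖ * ‖toLev (m + 1) ((hB N).sub hZ')‖ := add_le_add (hsq _ _ _ _) (hsq _ _ _ _)
      _ = _ := by rw [toLev_sub (m + 1) (hA N) hZ, toLev_sub (m + 1) (hB N) hZ']; ring
  have ht0 : Tendsto (fun N => Real.sqrt K * (‖toLev (m + 1) (hA N) - toLev (m + 1) hZ‖ * ‖toLev (m + 1) (hB N)‖ +
      ‖toLev (m + 1) hZ‖ * ‖toLev (m + 1) (hB N) - toLev (m + 1) hZ'‖)) atTop (𝓝 0) := by
    have h1 := tendsto_iff_norm_sub_tendsto_zero.1 htA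
    have h2 := tendsto_iff_norm_sub_tendsto_zero.1 htB
    have h3 := htB.norm
    have := ((h1.mul h3).add (h2.const_mul ‖toLev (m + 1) hZ‖)).const_mul (Real.sqrt K)
    simpa using this
  exact squeeze_zero (fun N => norm_nonneg _) hb ht0

/-- **On smooth fields the bilinear map is the bilinear form**: `bilExt (toLev Z) (toLev Z') = toLev (klBil Z Z')`.
[folklore] -/
theorem bilExt_toLev {Z Z' : UnitAddTorus (Fin 3) → ℝ³} (hZ : IsSmooth Z) (hZ' : IsSmooth Z') :
    bilExt hL hm (toLev (m + 1) hZ) (toLev (m + 1) hZ') = toLev m (isSmooth_klBil hL hZ hZ') := by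
  rw [bilExt_apply]
  refine tendsto_nhds_unique (tendsto_bilApprox hL hm _ _) ?_
  refine tendsto_toLev_klBil hL hm hZ hZ' (fun N => isSmooth_lvField (m + 1) N _) (fun N => isSmooth_lvField (m + 1) N _) ?_ ?_
  · simp_rw [toLev_lvField]; exact SymL2.tendsto_trunc _
  · simp_rw [toLev_lvField]; exact SymL2.tendsto_trunc _

/-- **Consistency with `𝒜̂`**: for `f` in the level-`s` space and `F = levelOf (m+1) f` (`m + 1 ≤ s`,
`ε ≠ 0`), `bilExt F F` is `klOpExt f` read at level `m`. [cite: KatoLai1984, §5 (5.6)] -/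
theorem atLevel_klOpExt_bilExt {s : ℕ} {ε : ℝ} (hε : ε ≠ 0) (hms : m + 1 ≤ s) (hs1 : 1 ≤ s) (f : SymL2 (Fin 3)) :
    AtLevel m (klOpExt hL s ε f) (bilExt hL hm (levelOf s hε hms hs1 f) (levelOf s hε hms hs1 f)) := by
  set F := levelOf s hε hms hs1 f with hF
  -- the truncations of `f` at weight `w` are the level trigonometric polynomials of `F`
  have hfield : ∀ N, truncField s ε N f = lvField (m + 1) N F := by
    intro N
    funext ξ
    simp only [truncField, lvField, realTrigPoly_apply, trigPoly_apply]
    congr 1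
    refine sum_congr rfl fun k _ => ?_
    congr 1
    rw [SymL2.coef_apply, SymL2.coef_apply, hF, levelOf, SymL2.diag_apply, smul_smul, levelOfSymbol]
    congr 1
    have hw : ((wt (m + 1) k : ℝ) : ℂ) ≠ 0 := by exact_mod_cast (wt_pos (m + 1) k).ne'
    push_cast
    field_simp
  have h1 : Tendsto (fun N => klOpApprox hL s ε N f) atTop (𝓝 (klOpExt hL s ε f)) := tendsto_klOpApprox hL s ε f
  have h2 : Tendsto (fun N => bilApprox hL m N F F) atTop (𝓝 (bilExt hL hm F F)) := by rw [bilExt_apply]; exact tendsto_bilApprox hL hm F F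
  refine AtLevel.of_tendsto (fun N => ?_) h1 h2
  -- `bilApprox N F F` is `klOpApprox N f` at level `m`
  have hU := isSmooth_truncField s ε N f
  have hV := isSmooth_lvField (m + 1) N F
  have e : klOp L hL hU = klBil hL hV hV := by
    rw [← klBil_self hL hU]
    exact klBil_congr hL hU hV hU hV (hfield N) (hfield N)
  intro k
  rw [bilApprox, klOpApprox, toLev, SymL2.ofSmooth_apply, SymL2.ofSmooth_apply, ← e]
  simp

end Bil

end PeriodicCylinder

end Literature.Analysis.FluidPDE
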